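import Literature.GroupTheory.BaireCountableIndexOpen
import HarnessLib

/-!
# A homomorphism of a compact group with continuous finite shadows and countable image has open kernel

A Baire-category rigidity principle for ABSTRACT homomorphisms `h : G → D` out of a compact topological
group `G` into a discrete group `D` (no topology on `D` is used): if `D` carries a family of normal
subgroups `N i` with trivial intersection («`D` is residually `(D ⧸ N i)`», e.g. the congruence
subgroups `{u ≡ 1 mod n}` of the unit group of an order, or the kernels `D → D ⧸ N i` of any
separating family of finite quotients), every «shadow» `G → D ⧸ N i` of `h` is continuous for the
discrete topology (i.e. `h⁻¹(N i)` is OPEN in `G`), and the image `h(G)` is countable, then `ker h` is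
OPEN — hence of finite index, and `h(G)` is FINITE.  Proof: `ker h = ⋂ i, h⁻¹(N i)` is an intersection
of open, hence closed, subgroups, so it is closed; its index `#h(G)` is countable; and a closed
subgroup of countable index of a compact (hence Baire) group is open (the tree's
`GroupTheory.isOpen_iff_countable_quotient_of_isClosed`, Baire category: Gao, *Invariant Descriptive
Set Theory*, Thm. 2.3.2 / Exercise 2.2.6; Dixon–du Sautoy–Mann–Segal, Prop. 1.2 (i) with Ch. 3
Exercise 6).  Equivalently: a countable compact Hausdorff group is finite.

Use (cell `hodgecm-mathlib`, sub-line `a2b-twisted-galois-model` of the `h21` line, stub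
`stub_cocycleDescent`, Shimura 1998 p. 192 «for the same reason as in the proof of Proposition 21.1»):
for a structure `(A₁, ι)` of CM type over a number field `k₁` the isomorphisms `λ_σ : A → A^σ` of the
main theorem of complex multiplication are, for `σ ∈ Gal(k̄/k₁)`, of the form `can_σ ∘ ι(u_σ)` with
`u_σ` a unit of `𝓞_K` — a COUNTABLE group with no useful topology — and `σ ↦ u_σ` is a homomorphism
whose reductions modulo every `n` are continuous (they are read off the Galois action on the finite set
`A₁[n]`); this file then gives local constancy of `σ ↦ λ_σ` (an open kernel) with NO appeal to
polarisations or to the finiteness of `Aut(A, ι, 𝒞)`.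

Everything is Mathlib + `GroupTheory/BaireCountableIndexOpen`; no definition, no named fact
(PROOF-ONLY file, net Literature debt 0).

## Main results

* `GroupTheory.isClosed_ker_of_isOpen_comap` — `ker h = ⋂ i, h⁻¹(N i)` is closed if every
  `h⁻¹(N i)` is open and `⋂ N i = 1`.
* `GroupTheory.isOpen_ker_of_isOpen_comap_of_countable` — **the principle**: `G` compact,
  `h⁻¹(N i)` open for all `i`, `⋂ N i = 1`, `h(G)` countable ⇒ `ker h` open.
* `GroupTheory.finite_range_of_isOpen_comap_of_countable` — … and `h(G)` is finite.
* `…_of_countable_codomain` variants for a countable `D`.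

## References

* [Gao2009InvariantDST] Su Gao, *Invariant Descriptive Set Theory*, CRC Press (2009), §2.3
  Thm. 2.3.2 (Pettis), Exercise 2.2.6.
* [DDMSAnalyticProP1999] J. D. Dixon, M. du Sautoy, A. Mann, D. Segal, *Analytic pro-p groups*,
  2nd ed. (1999), Prop. 1.2 (i), Ch. 3 Exercise 6.
-/

namespace Literature.GroupTheory

open scoped _root_.Topology
open _root_.Set

section Algebra

variable {G : Type*} [Group G] {D : Type*} [Group D] {ι : Sort*}

/-- `ker h = ⨅ i, h⁻¹(N i)` for a family of subgroups `N i ≤ D` with trivial intersection (stated as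
`∀ d, (∀ i, d ∈ N i) → d = 1`). [folklore] -/
private theorem ker_eq_iInf_comap_of_forall_eq_one (h : G →* D) (N : ι → Subgroup D)
    (hN : ∀ d : D, (∀ i, d ∈ N i) → d = 1) : h.ker = ⨅ i, (N i).comap h := by
  ext g
  simp only [MonoidHom.mem_ker, Subgroup.mem_iInf, Subgroup.mem_comap]
  exact ⟨fun hg i => hg ▸ (N i).one_mem, hN (h g)⟩

/-- The index of `ker h` is the cardinality of the image: `G ⧸ ker h` is countable as soon as `h(G)` is
(first isomorphism theorem, Mathlib `QuotientGroup.quotientKerEquivRange`). [folklore] -/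
private theorem countable_quotient_ker_of_countable_range (h : G →* D) [Countable h.range] :
    Countable (G ⧸ h.ker) :=
  Countable.of_equiv _ (QuotientGroup.quotientKerEquivRange h).toEquiv.symm

end Algebra

variable {G : Type*} [Group G] [TopologicalSpace G] [IsTopologicalGroup G]
  {D : Type*} [Group D] {ι : Sort*}

/-- If every `h⁻¹(N i)` is an OPEN subgroup of the topological group `G` and `⋂ N i = 1`, then
`ker h = ⋂ i, h⁻¹(N i)` is CLOSED (open subgroups are closed: DDMS Prop. 1.2 (i), Mathlib
`Subgroup.isClosed_of_isOpen`). [cite: DDMSAnalyticProP1999, Prop 1.2 (i)] -/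
theorem isClosed_ker_of_isOpen_comap (h : G →* D) (N : ι → Subgroup D)
    (hN : ∀ d : D, (∀ i, d ∈ N i) → d = 1) (hopen : ∀ i, IsOpen ((N i).comap h : Set G)) :
    IsClosed (h.ker : Set G) := by
  rw [ker_eq_iInf_comap_of_forall_eq_one h N hN, Subgroup.coe_iInf]
  exact isClosed_iInter fun i => Subgroup.isClosed_of_isOpen _ (hopen i)

variable [CompactSpace G]

/-- **Open-kernel principle.** Let `G` be a compact topological group, `D` any group, `N i ≤ D`
subgroups with `⋂ i, N i = 1`, and `h : G →* D` a homomorphism such that every `h⁻¹(N i)` is open in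
`G` (each shadow `G → D ⧸ N i` is continuous for the discrete topology) and `h(G)` is countable.  Then
`ker h` is OPEN: it is a closed subgroup (`isClosed_ker_of_isOpen_comap`) of countable index in a
compact, hence Baire, group (Gao Thm. 2.3.2 / Exercise 2.2.6; DDMS Prop. 1.2 (i), Ch. 3 Ex. 6 — the
tree's `isOpen_iff_countable_quotient_of_isClosed`). [cite: Gao2009InvariantDST, §2.3 Thm 2.3.2 (Pettis) and §2.2 Exercise 2.2.6]
[cite: DDMSAnalyticProP1999, Prop 1.2 (i) and Ch.3 Exercise 6] -/
theorem isOpen_ker_of_isOpen_comap_of_countable (h : G →* D) (N : ι → Subgroup D)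
    (hN : ∀ d : D, (∀ i, d ∈ N i) → d = 1) (hopen : ∀ i, IsOpen ((N i).comap h : Set G))
    [Countable h.range] : IsOpen (h.ker : Set G) :=
  haveI := countable_quotient_ker_of_countable_range h
  (isOpen_iff_countable_quotient_of_isClosed h.ker (isClosed_ker_of_isOpen_comap h N hN hopen)).2
    inferInstance

/-- … and then the image `h(G)` is FINITE (an open subgroup of a compact group has finite index,
`finite_quotient_of_isOpen`, and `G ⧸ ker h ≃ h(G)`).  In words: a compact group takes only finitely
many values in a countable group along a homomorphism with continuous point-separating finite
shadows. [cite: DDMSAnalyticProP1999, Prop 1.2 (i) and Ch.3 Exercise 6] -/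
theorem finite_range_of_isOpen_comap_of_countable (h : G →* D) (N : ι → Subgroup D)
    (hN : ∀ d : D, (∀ i, d ∈ N i) → d = 1) (hopen : ∀ i, IsOpen ((N i).comap h : Set G))
    [Countable h.range] : Finite h.range :=
  haveI := finite_quotient_of_isOpen h.ker (isOpen_ker_of_isOpen_comap_of_countable h N hN hopen)
  Finite.of_equiv _ (QuotientGroup.quotientKerEquivRange h).toEquiv

/-- Open-kernel principle for a COUNTABLE target group `D` (e.g. the unit group of an order in a
number field, `D = 𝓞_K^×`). [cite: Gao2009InvariantDST, §2.3 Thm 2.3.2 (Pettis) and §2.2 Exercise 2.2.6] -/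
theorem isOpen_ker_of_isOpen_comap_of_countable_codomain [Countable D] (h : G →* D)
    (N : ι → Subgroup D) (hN : ∀ d : D, (∀ i, d ∈ N i) → d = 1)
    (hopen : ∀ i, IsOpen ((N i).comap h : Set G)) : IsOpen (h.ker : Set G) :=
  isOpen_ker_of_isOpen_comap_of_countable h N hN hopen

/-- Finite image for a COUNTABLE target group `D`. [cite: DDMSAnalyticProP1999, Prop 1.2 (i) and Ch.3 Exercise 6] -/
theorem finite_range_of_isOpen_comap_of_countable_codomain [Countable D] (h : G →* D)
    (N : ι → Subgroup D) (hN : ∀ d : D, (∀ i, d ∈ N i) → d = 1)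
    (hopen : ∀ i, IsOpen ((N i).comap h : Set G)) : Finite h.range :=
  finite_range_of_isOpen_comap_of_countable h N hN hopen

end Literature.GroupTheory
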